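import Literature.NumberTheory.LFunctions.Zhang2022.SkeletonPartThree
import Literature.NumberTheory.LFunctions.Zhang2022.SkeletonWindowPowers
import Literature.NumberTheory.LFunctions.Zhang2022.TypedSection01and02B
import HarnessLib

/-!
# Zhang (2022) §8: the circle-integral steps in the proof of Lemma 8.2, kernel-checked

Cell `siegel-zhang` (D-0069 width campaign), layer L2. DAG nodes of Y. Zhang, *Discrete mean
estimates and the Landau–Siegel zero*, arXiv:2211.02515v1 [Zhang2022LandauSiegel] — **an unrefereed
manuscript under adjudication; this file proves displayed proof steps / deductions and asserts
nothing about its Theorems 1–2 or about Landau–Siegel zeros.**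

* `Z22:§8.u030`, second equality [Z22 p.46, tex L2363–2366] (proof of Lemma 8.2):
  "`(1/2πi)∮_{|s|=5α} L(1−β_j+s,χ) x^s ds/(s−β_μ)² = L′(1,χ)·(1/2πi)∮_{|s|=5α} x^s(s−β_j)(s−β_μ)⁻² ds
  + O(𝓛⁻⁶)`" (`T < x < P`) — `circle82_sub_le`, DISCHARGED from the tree's Lemma 5.8
  (`Skeleton.lemma58_holds`: `L(s,χ) = L′(1,χ)(s−1) + O(𝓛⁻¹⁵)` for `α ≤ |s−1| ≤ 10α`). The printed
  attribution is "It follows by Lemma 5.6"; the input actually consumed here is Lemma 5.8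
  (recorded, not judged).
* `Z22:§8.u030`, first line ⇒ second line: `sum82CircleMainTerm_of_viaCircle` — the printed
  contour-shift output ("`… = (1/2πi)∮_{|s|=5α} L(1−β_j+s,χ)x^s(s−β_μ)⁻² ds + O(ε₁)`",
  `ε₁ = exp{−c𝓛^{1/10}}`; L2-t6's `Typed.S8B.Sum82ViaCircle`, taken as a hypothesis) implies the
  second line (L2-t6's `Typed.S8B.Sum82CircleMainTerm`), which L2-t6's `lemma82_of_circleMainTerm`
  ("direct calculation", tree `circleIntegral_lemma82`) turns into `Skeleton.Lemma82`. Statement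
  shapes are those typed decls unfolded (`circInt R F = (2πi)⁻¹∮_{C(0,R)} F`); bridges are one-liners
  once `TypedSection08B` (p412401) is in the tree.

Also the parameter bookkeeping shared with the Lemma 8.4 companion file
(`Section8Lemma84Steps`): `α = π𝓛⁻⁹`, `|β_μ| ≤ 5α/2`, `β_μ ≠ 0`, `|β_j| ≤ 7α/2` once
`5|c′|α𝓛 ≤ 1/6` (i.e. `𝓛 ≥ 30π|c′| + 3`), `|x^s| ≤ e^{5π}` on `|s| = 5α` for `T < x < P`, and
`ε₁ ≤ (60!/c⁶⁰)𝓛⁻⁶`.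

Conventions: `x^s` is Mathlib's `(x : ℂ) ^ s` (`= e^{s log x}` for `x > 0`, as in
`Section8MainTerms`); `(1/2πi)∮_{|s|=5α}` is Mathlib's `(2πi)⁻¹ ∮ z in C(0, 5α)`. Hypotheses are
spelled out in the statements (this file declares no `Prop`), in the skeleton's vocabulary
(`ForAllLarge`, `AssumptionA`, `betaJ`, `betaMu`). Lemma 8.2 itself is ALREADY a theorem of the
tree by a different route (`Skeleton.lemma82_holds`, partial summation); what is checked here is
the manuscript's own chain of displayed steps.

Not touched (named residual CLAIM): the contour shift itself (`Z22:§8.u028`–`u030` line 1).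
-/

noncomputable section

open Complex Real Metric

namespace Literature.NumberTheory.LFunctions.Zhang2022.Section8Lemma82Steps

open Literature.NumberTheory.LFunctions.Zhang2022.Skeleton

/-! ### Parameter bookkeeping: `α = π𝓛⁻⁹`, `|β_μ| ≤ 5α/2`, `|β_j| ≤ 7α/2` for large `D` -/

/-- `𝓛 ≥ 3` once `D ≥ ⌈e³⌉` (any larger threshold works). [cite: Zhang2022LandauSiegel, §2 p.4] -/
theorem three_le_ell {D : ℕ} {M : ℝ} (hM : 3 ≤ M) (hD : ⌈Real.exp M⌉₊ ≤ D) : 3 ≤ ell D := by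
  have hexp : Real.exp M ≤ D := le_trans (Nat.le_ceil _) (by exact_mod_cast hD)
  have hlog : M ≤ Real.log D :=
    (Real.le_log_iff_exp_le (lt_of_lt_of_le (Real.exp_pos _) hexp)).mpr hexp
  rw [ell]; linarith

/-- `log D ≥ M` once `D ≥ ⌈e^M⌉`. [cite: Zhang2022LandauSiegel, §2 p.4] -/
theorem le_ell {D : ℕ} {M : ℝ} (hD : ⌈Real.exp M⌉₊ ≤ D) : M ≤ ell D := by
  have hexp : Real.exp M ≤ D := le_trans (Nat.le_ceil _) (by exact_mod_cast hD)
  rw [ell]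
  exact (Real.le_log_iff_exp_le (lt_of_lt_of_le (Real.exp_pos _) hexp)).mpr hexp

/-- `D ≥ 3` when `𝓛 = log D ≥ 3` (indeed `D ≥ e³`). [cite: Zhang2022LandauSiegel, §2 p.4] -/
theorem three_le_of_ell {D : ℕ} (h : 3 ≤ ell D) : 3 ≤ D := by
  by_contra hD
  have hD' : D ≤ 2 := by omega
  have : ell D ≤ Real.log 2 := by
    rw [ell]
    rcases Nat.eq_zero_or_pos D with h0 | hpos
    · rw [h0, Nat.cast_zero, Real.log_zero]; exact Real.log_nonneg one_le_two
    · exact Real.log_le_log (by exact_mod_cast hpos) (by exact_mod_cast hD')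
  linarith [Real.log_two_lt_d9]

/-- `|β_μ| ≤ 5α/2` (`β₆ = 3iα/2`, `β₇ = 5iα/2`; any other index is sent to `β₆`).
[cite: Zhang2022LandauSiegel, §2 (2.22)] -/
theorem norm_betaMu_le {D : ℕ} (μ : ℕ) (hα : 0 ≤ alpha D) : ‖betaMu D μ‖ ≤ 5 / 2 * alpha D := by
  unfold betaMu beta6 beta7
  split_ifs
  · rw [norm_div, norm_mul, norm_mul, Complex.norm_I, Complex.norm_real, Real.norm_eq_abs,
      abs_of_nonneg hα]
    norm_num; linarith
  · rw [norm_div, norm_mul, norm_mul, Complex.norm_I, Complex.norm_real, Real.norm_eq_abs,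
      abs_of_nonneg hα]
    norm_num; linarith

/-- `β_μ ≠ 0` when `α ≠ 0`. [cite: Zhang2022LandauSiegel, §2 (2.22)] -/
theorem betaMu_ne_zero {D : ℕ} (μ : ℕ) (hα : alpha D ≠ 0) : betaMu D μ ≠ 0 := by
  have hα' : (alpha D : ℂ) ≠ 0 := by exact_mod_cast hα
  unfold betaMu beta6 beta7
  split_ifs <;> simp [hα', Complex.I_ne_zero]

/-- `|β_j| ≤ 7α/2` once `5|c′|α𝓛 ≤ 1/6` (then `|1 − 5c′α𝓛| ≤ 7/6`, `|1 ± c′α𝓛| ≤ 31/30`).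
[cite: Zhang2022LandauSiegel, §2 (2.13)] -/
theorem norm_betaJ_le {c' : ℝ} {D : ℕ} (j : ℕ) (hα : 0 ≤ alpha D) (hℓ : 0 ≤ ell D)
    (h : 5 * |c'| * alpha D * ell D ≤ 1 / 6) : ‖betaJ c' D j‖ ≤ 7 / 2 * alpha D := by
  have hcaℓ : |c' * alpha D * ell D| ≤ 1 / 30 := by
    rw [abs_mul, abs_mul, abs_of_nonneg hα, abs_of_nonneg hℓ]; nlinarith
  have h1 : |1 - 5 * c' * alpha D * ell D| ≤ 7 / 6 := by
    calc |1 - 5 * c' * alpha D * ell D| ≤ |(1:ℝ)| + |5 * c' * alpha D * ell D| := abs_sub _ _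
      _ ≤ 1 + 5 * (1 / 30) := by
          rw [abs_one, show 5 * c' * alpha D * ell D = 5 * (c' * alpha D * ell D) by ring,
            abs_mul, abs_of_pos (by norm_num : (0:ℝ) < 5)]
          linarith
      _ = 7 / 6 := by norm_num
  have h2 : |1 + c' * alpha D * ell D| ≤ 31 / 30 := by
    calc |1 + c' * alpha D * ell D| ≤ |(1:ℝ)| + |c' * alpha D * ell D| := abs_add_le _ _
      _ ≤ 31 / 30 := by rw [abs_one]; linarith
  have h3 : |1 - c' * alpha D * ell D| ≤ 31 / 30 := by
    calc |1 - c' * alpha D * ell D| ≤ |(1:ℝ)| + |c' * alpha D * ell D| := abs_sub _ _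
      _ ≤ 31 / 30 := by rw [abs_one]; linarith
  unfold betaJ beta1 beta2 beta3
  split_ifs
  · rw [norm_mul, norm_mul, Complex.norm_I, Complex.norm_real, Complex.norm_real,
      Real.norm_eq_abs, Real.norm_eq_abs, abs_of_nonneg hα]
    nlinarith
  · rw [norm_mul, norm_mul, norm_mul, Complex.norm_I, Complex.norm_real, Complex.norm_real,
      Real.norm_eq_abs, Real.norm_eq_abs, abs_of_nonneg hα]
    norm_num; nlinarith
  · rw [norm_mul, norm_mul, norm_mul, Complex.norm_I, Complex.norm_real, Complex.norm_real,
      Real.norm_eq_abs, Real.norm_eq_abs, abs_of_nonneg hα]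
    norm_num; nlinarith

/-- The largeness condition `5|c′|α𝓛 ≤ 1/6` holds once `𝓛 ≥ 30π|c′| + 3` (since `α𝓛 = π𝓛⁻⁸ ≤ π/𝓛`).
[cite: Zhang2022LandauSiegel, §2 (2.13)] -/
theorem small_shift_of_ell_ge {c' : ℝ} {D : ℕ} (hℓ : 30 * π * |c'| + 3 ≤ ell D) :
    5 * |c'| * alpha D * ell D ≤ 1 / 6 := by
  have hℓ3 : 3 ≤ ell D := by nlinarith [Real.pi_pos, abs_nonneg c']
  have hℓ1 : 1 ≤ ell D := by linarith
  rw [Section2.alpha_eq_pi_div_ell9]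
  have hℓ8 : ell D ≤ ell D ^ 8 := by
    calc ell D = ell D ^ 1 := (pow_one _).symm
      _ ≤ ell D ^ 8 := pow_le_pow_right₀ hℓ1 (by norm_num)
  have hpos : 0 < ell D ^ 9 := by positivity
  rw [show 5 * |c'| * (π / ell D ^ 9) * ell D = 5 * π * |c'| * ell D / ell D ^ 9 by ring,
    div_le_iff₀ hpos]
  have : ell D ^ 9 = ell D ^ 8 * ell D := by ring
  rw [this]
  have hc : 0 ≤ |c'| := abs_nonneg c'
  nlinarith [Real.pi_pos, mul_nonneg (mul_nonneg Real.pi_pos.le hc) (by linarith : (0:ℝ) ≤ ell D)]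

/-! ### `Z22:§8.u030`, second equality: replacing `L(1−β_j+s,χ)` by `L′(1,χ)(s−β_j)` on `|s| = 5α` -/

/-- The norm of `x^s = e^{s log x}` on the circle `|s| = 5α` for `T < x < P`: `‖e^{s log x}‖ ≤ e^{5π}`
(`Re s ≤ 5α`, `0 ≤ log x ≤ log P = 𝓛⁹`, `α𝓛⁹ = π`). [cite: Zhang2022LandauSiegel, §8 Lemma 8.2 (proof)] -/
theorem norm_cexp_mul_log_le {D : ℕ} {y : ℝ} (hℓ : 0 < ell D) (hTy : bigT D < y) (hyP : y < bigP D)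
    {z : ℂ} (hz : ‖z‖ ≤ 5 * alpha D) : ‖cexp (z * (Real.log y : ℂ))‖ ≤ Real.exp (5 * π) := by
  have hT1 : 1 ≤ bigT D := by rw [bigT]; exact Real.one_le_exp (by positivity)
  have hy1 : 1 < y := lt_of_le_of_lt hT1 hTy
  have hy0 : 0 < y := by linarith
  have hlog0 : 0 ≤ Real.log y := Real.log_nonneg hy1.le
  have hlogP : Real.log y ≤ ell D ^ 9 := by
    have := Real.log_le_log hy0 hyP.le
    rwa [bigP, Real.log_exp] at this
  rw [Complex.norm_exp]
  apply Real.exp_le_exp.mpr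
  have hre : (z * (Real.log y : ℂ)).re = z.re * Real.log y := by simp [Complex.mul_re]
  rw [hre]
  have hzre : z.re ≤ 5 * alpha D := le_trans (Complex.re_le_norm z) hz
  calc z.re * Real.log y ≤ 5 * alpha D * Real.log y := by nlinarith
    _ ≤ 5 * alpha D * ell D ^ 9 := by
        have := (alpha_pos' hℓ).le; nlinarith
    _ = 5 * π := by rw [Section2.alpha_eq_pi_div_ell9]; field_simp

/-- **`Z22:§8.u030`, second equality** [Z22 p.46, tex L2363–2366]: under (A), for `T < x < P`,
`j` arbitrary (`β_j ∈ {β₁,β₂,β₃}`), `μ` arbitrary (`β_μ ∈ {β₆,β₇}`),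
`‖(1/2πi)∮_{|s|=5α} L(1−β_j+s,χ)x^s(s−β_μ)⁻² ds − L′(1,χ)·(1/2πi)∮_{|s|=5α} x^s(s−β_j)(s−β_μ)⁻² ds‖
≤ C𝓛⁻⁶`. DISCHARGED from `Skeleton.lemma58_holds` (on the circle `α ≤ |s − β_j| ≤ 10α`, the circle
has length `10πα`, `|x^s| ≤ e^{5π}`, `|s − β_μ| ≥ 5α/2`, and `𝓛⁻¹⁵/α = π⁻¹𝓛⁻⁶`). The manuscript
says "by Lemma 5.6"; the input used is Lemma 5.8. [cite: Zhang2022LandauSiegel, §8 Lemma 8.2 (proof), p.46] -/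
theorem circle82_sub_le (c' : ℝ) : ∃ C : ℝ, ForAllLarge fun D _ χ => AssumptionA D χ →
    ∀ j μ : ℕ, ∀ y : ℝ, bigT D < y → y < bigP D →
      ‖(2 * π * I)⁻¹ * (∮ s in C((0 : ℂ), 5 * alpha D),
            χ.LFunction (1 - betaJ c' D j + s) * (y : ℂ) ^ s / (s - betaMu D μ) ^ 2) -
        deriv χ.LFunction 1 * ((2 * π * I)⁻¹ * (∮ s in C((0 : ℂ), 5 * alpha D),
            (y : ℂ) ^ s * (s - betaJ c' D j) / (s - betaMu D μ) ^ 2))‖ ≤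
        C * (ell D ^ 6)⁻¹ := by
  obtain ⟨C₅₈, D₅₈, h58⟩ := lemma58_holds
  set C₁ : ℝ := max C₅₈ 0 with hC₁
  have hC₁0 : 0 ≤ C₁ := le_max_right _ _
  refine ⟨C₁ * Real.exp (5 * π), max D₅₈ ⌈Real.exp (30 * π * |c'| + 3)⌉₊,
    fun D _ χ hD hq hp hA j μ y hTy hyP => ?_⟩
  have hD58 : D₅₈ ≤ D := le_trans (le_max_left _ _) hD
  have hℓ' : 30 * π * |c'| + 3 ≤ ell D := le_ell (le_trans (le_max_right _ _) hD)
  have hℓ3 : 3 ≤ ell D := by nlinarith [Real.pi_pos, abs_nonneg c']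
  have hℓ0 : 0 < ell D := by linarith
  have hα0 : 0 < alpha D := alpha_pos' hℓ0
  have hsmall := small_shift_of_ell_ge hℓ'
  have hβj : ‖betaJ c' D j‖ ≤ 7 / 2 * alpha D := norm_betaJ_le j hα0.le hℓ0.le hsmall
  have hβμ : ‖betaMu D μ‖ ≤ 5 / 2 * alpha D := norm_betaMu_le μ hα0.le
  have hD3 : 3 ≤ D := three_le_of_ell hℓ3
  have hne1 : χ ≠ 1 := ne_one_of_isPrimitive_of_three_le hp hD3
  -- `x^s = e^{s log x}` (`x > T ≥ 1 > 0`)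
  have hT1 : 1 ≤ bigT D := by rw [bigT]; exact Real.one_le_exp (by positivity)
  have hy0 : 0 < y := by linarith
  have hxs : ∀ s : ℂ, (y : ℂ) ^ s = cexp (s * (Real.log y : ℂ)) := fun s => by
    rw [Complex.cpow_def_of_ne_zero (Complex.ofReal_ne_zero.mpr hy0.ne'), ← Complex.ofReal_log hy0.le,
      mul_comm]
  simp only [hxs]
  -- Lemma 5.8 on the circle
  have h58' : ∀ z : ℂ, ‖z‖ = 5 * alpha D →
      ‖χ.LFunction (1 - betaJ c' D j + z) - deriv χ.LFunction 1 * (z - betaJ c' D j)‖ ≤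
        C₁ * (ell D ^ 15)⁻¹ := by
    intro z hz
    have hlow : alpha D ≤ ‖(1 - betaJ c' D j + z) - 1‖ := by
      rw [show (1 - betaJ c' D j + z) - 1 = z - betaJ c' D j by ring]
      have := norm_sub_norm_le z (betaJ c' D j)
      linarith
    have hup : ‖(1 - betaJ c' D j + z) - 1‖ ≤ 10 * alpha D := by
      rw [show (1 - betaJ c' D j + z) - 1 = z - betaJ c' D j by ring]
      have := norm_sub_le z (betaJ c' D j)
      linarith
    have := h58 D χ hD58 hq hp hA _ hlow hup
    rw [show (1 - betaJ c' D j + z) - 1 = z - betaJ c' D j by ring] at this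
    exact this.trans (mul_le_mul_of_nonneg_right (le_max_left _ _) (by positivity))
  -- the integrands
  set L : ℂ := (Real.log y : ℂ) with hL
  set a : ℂ := deriv χ.LFunction 1 with ha
  set f₁ : ℂ → ℂ := fun s => χ.LFunction (1 - betaJ c' D j + s) * cexp (s * L) /
    (s - betaMu D μ) ^ 2 with hf₁
  set f₂ : ℂ → ℂ := fun s => cexp (s * L) * (s - betaJ c' D j) / (s - betaMu D μ) ^ 2 with hf₂
  have hR : 0 ≤ 5 * alpha D := by positivity
  have hsph : ∀ z ∈ sphere (0 : ℂ) (5 * alpha D), ‖z‖ = 5 * alpha D := fun z hz => by simpa using hz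
  have hden : ∀ z ∈ sphere (0 : ℂ) (5 * alpha D), 5 / 2 * alpha D ≤ ‖z - betaMu D μ‖ := by
    intro z hz
    have := norm_sub_norm_le z (betaMu D μ)
    rw [hsph z hz] at this
    linarith
  have hden0 : ∀ z ∈ sphere (0 : ℂ) (5 * alpha D), z - betaMu D μ ≠ 0 := by
    intro z hz h
    have := hden z hz
    rw [h, norm_zero] at this
    linarith
  -- continuity ⇒ circle integrability
  have hLc : Continuous fun s : ℂ => χ.LFunction (1 - betaJ c' D j + s) :=
    (DirichletCharacter.differentiable_LFunction hne1).continuous.comp (by fun_prop)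
  have hc₁ : ContinuousOn f₁ (sphere (0 : ℂ) (5 * alpha D)) := by
    refine ContinuousOn.div ?_ ?_ (fun z hz => pow_ne_zero 2 (hden0 z hz))
    · exact (hLc.mul (by fun_prop)).continuousOn
    · fun_prop
  have hc₂ : ContinuousOn f₂ (sphere (0 : ℂ) (5 * alpha D)) := by
    refine ContinuousOn.div ?_ ?_ (fun z hz => pow_ne_zero 2 (hden0 z hz))
    · fun_prop
    · fun_prop
  have hi₁ : CircleIntegrable f₁ 0 (5 * alpha D) := hc₁.circleIntegrable hR
  have hi₂ : CircleIntegrable f₂ 0 (5 * alpha D) := hc₂.circleIntegrable hR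
  -- rewrite the difference as one circle integral
  have hi₂' : CircleIntegrable (fun s => a * f₂ s) 0 (5 * alpha D) :=
    (continuousOn_const.mul hc₂).circleIntegrable hR
  have hcomb : (2 * π * I)⁻¹ * (∮ s in C((0 : ℂ), 5 * alpha D), f₁ s) -
      a * ((2 * π * I)⁻¹ * (∮ s in C((0 : ℂ), 5 * alpha D), f₂ s)) =
      (2 * π * I)⁻¹ • (∮ s in C((0 : ℂ), 5 * alpha D), (f₁ s - a * f₂ s)) := by
    rw [circleIntegral.integral_sub hi₁ hi₂', circleIntegral.integral_const_mul, smul_eq_mul]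
    ring
  rw [hcomb]
  -- pointwise bound on the circle
  set M : ℝ := C₁ * (ell D ^ 15)⁻¹ * Real.exp (5 * π) / (5 / 2 * alpha D) ^ 2 with hM
  have hbound : ∀ z ∈ sphere (0 : ℂ) (5 * alpha D), ‖f₁ z - a * f₂ z‖ ≤ M := by
    intro z hz
    have hz' := hsph z hz
    have e : f₁ z - a * f₂ z = (χ.LFunction (1 - betaJ c' D j + z) - a * (z - betaJ c' D j)) *
        cexp (z * L) / (z - betaMu D μ) ^ 2 := by
      simp only [hf₁, hf₂]; ring
    rw [e, norm_div, norm_mul, norm_pow]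
    have h1 := h58' z hz'
    have h2 : ‖cexp (z * L)‖ ≤ Real.exp (5 * π) := norm_cexp_mul_log_le hℓ0 hTy hyP hz'.le
    have h3 := hden z hz
    have h3' : (5 / 2 * alpha D) ^ 2 ≤ ‖z - betaMu D μ‖ ^ 2 := by
      have : 0 ≤ 5 / 2 * alpha D := by positivity
      nlinarith
    have hd0 : 0 < (5 / 2 * alpha D) ^ 2 := by positivity
    rw [hM, div_le_div_iff₀ (lt_of_lt_of_le hd0 h3') hd0]
    have hnum : ‖χ.LFunction (1 - betaJ c' D j + z) - a * (z - betaJ c' D j)‖ * ‖cexp (z * L)‖ ≤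
        C₁ * (ell D ^ 15)⁻¹ * Real.exp (5 * π) :=
      mul_le_mul h1 h2 (norm_nonneg _) (by positivity)
    calc ‖χ.LFunction (1 - betaJ c' D j + z) - a * (z - betaJ c' D j)‖ * ‖cexp (z * L)‖ *
          (5 / 2 * alpha D) ^ 2
        ≤ C₁ * (ell D ^ 15)⁻¹ * Real.exp (5 * π) * (5 / 2 * alpha D) ^ 2 :=
          mul_le_mul_of_nonneg_right hnum hd0.le
      _ ≤ C₁ * (ell D ^ 15)⁻¹ * Real.exp (5 * π) * ‖z - betaMu D μ‖ ^ 2 :=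
          mul_le_mul_of_nonneg_left h3' (by positivity)
  refine (circleIntegral.norm_two_pi_i_inv_smul_integral_le_of_norm_le_const hR hbound).trans ?_
  -- `5α · M = (4/(5π)) C₁ e^{5π} 𝓛⁻⁶ ≤ C₁ e^{5π} 𝓛⁻⁶`
  have hℓne : ell D ≠ 0 := hℓ0.ne'
  have hπ : (π : ℝ) ≠ 0 := Real.pi_pos.ne'
  have key : 5 * alpha D * M = C₁ * Real.exp (5 * π) * (ell D ^ 6)⁻¹ * (4 / (5 * π)) := by
    rw [hM, Section2.alpha_eq_pi_div_ell9]
    field_simp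
    ring
  rw [key]
  have h45 : 4 / (5 * π) ≤ 1 := by
    rw [div_le_one (by positivity)]; linarith [Real.pi_gt_three]
  calc C₁ * Real.exp (5 * π) * (ell D ^ 6)⁻¹ * (4 / (5 * π))
      ≤ C₁ * Real.exp (5 * π) * (ell D ^ 6)⁻¹ * 1 := by gcongr
    _ = C₁ * Real.exp (5 * π) * (ell D ^ 6)⁻¹ := mul_one _

/-- `exp(−c𝓛^{1/10}) ≤ (60!/c⁶⁰)·𝓛⁻⁶` for `𝓛 > 0`, `c > 0`: the manuscript's `ε₁ = exp{−c𝓛^{1/10}}`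
(§7 p.40) is smaller than any fixed power `𝓛⁻ᵏ` up to a constant. [cite: Zhang2022LandauSiegel, §7 p.40] -/
theorem exp_neg_rpow_tenth_le {c ℓ : ℝ} (hc : 0 < c) (hℓ : 0 < ℓ) :
    Real.exp (-(c * ℓ ^ (1 / 10 : ℝ))) ≤ (Nat.factorial 60 : ℝ) / c ^ 60 * (ℓ ^ 6)⁻¹ := by
  set u : ℝ := ℓ ^ (1 / 10 : ℝ) with hu
  have hu0 : 0 < u := Real.rpow_pos_of_pos hℓ _
  have hu60 : u ^ 60 = ℓ ^ 6 := by
    rw [hu, ← Real.rpow_natCast, ← Real.rpow_mul hℓ.le]; norm_num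
  have hfact := Real.pow_div_factorial_le_exp (c * u) (by positivity) 60
  have hf0 : (0 : ℝ) < Nat.factorial 60 := by exact_mod_cast Nat.factorial_pos 60
  have hexp : 0 < Real.exp (c * u) := Real.exp_pos _
  have hcu : 0 < (c * u) ^ 60 := by positivity
  have h1 : 1 * (c * u) ^ 60 ≤ (Nat.factorial 60 : ℝ) * Real.exp (c * u) := by
    rw [one_mul]
    have := hfact
    rw [div_le_iff₀ hf0] at this
    linarith
  have h2 : Real.exp (-(c * u)) ≤ (Nat.factorial 60 : ℝ) / (c * u) ^ 60 := by
    rw [Real.exp_neg, inv_eq_one_div, div_le_div_iff₀ hexp hcu]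
    exact h1
  calc Real.exp (-(c * u)) ≤ (Nat.factorial 60 : ℝ) / (c * u) ^ 60 := h2
    _ = (Nat.factorial 60 : ℝ) / c ^ 60 * (ℓ ^ 6)⁻¹ := by
        rw [mul_pow, hu60]
        field_simp

/-! ### `Z22:§8.u030`: first line ⇒ second line -/

/-- **`Z22:§8.u030`, the inference from its first to its second line** [Z22 p.45–46, tex
L2363–2366]: IF the contour shift holds as printed ("It follows by Lemma 5.6 that
`Σ_{m<x} … = (1/2πi)∮_{|s|=5α} L(1−β_j+s,χ)x^s(s−β_μ)⁻² ds + O(ε₁)`", `ε₁ = exp{−c𝓛^{1/10}}`; the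
shape of L2-t6's `Typed.S8B.Sum82ViaCircle c′`, unfolded), THEN the second line holds
("`= L′(1,χ)·(1/2πi)∮_{|s|=5α} x^s(s−β_j)(s−β_μ)⁻² ds + O(𝓛⁻⁶)`"; the shape of
`Typed.S8B.Sum82CircleMainTerm c′`, unfolded) — by `circle82_sub_le` and `ε₁ ≤ (60!/c⁶⁰)𝓛⁻⁶`.
Composed with L2-t6's `lemma82_of_circleMainTerm` ("direct calculation", tree
`circleIntegral_lemma82`) this is the manuscript's route to Lemma 8.2; the only undischarged link of
`Z22:Lem8.2.pf` is then the first line of `u030` itself. The hypothesis is NOT asserted here.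
[cite: Zhang2022LandauSiegel, §8 Lemma 8.2 (proof), pp.45–46] -/
theorem sum82CircleMainTerm_of_viaCircle (c' : ℝ)
    (h030a : ∃ c : ℝ, 0 < c ∧ ∃ C : ℝ, ForAllLarge fun D _ χ => AssumptionA D χ →
      ∀ j ∈ ({1, 2, 3} : Finset ℕ), ∀ μ ∈ ({6, 7} : Finset ℕ), ∀ y : ℝ, bigT D < y → y < bigP D →
        ‖(∑ m ∈ Finset.Ico 1 ⌈y⌉₊, χ (m : ZMod D) / (m : ℂ) ^ (1 - betaJ c' D j) *
              ((y / m : ℝ) : ℂ) ^ betaMu D μ * (Real.log (y / m) : ℂ)) -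
          (2 * π * I)⁻¹ * (∮ s in C((0 : ℂ), 5 * alpha D),
            χ.LFunction (1 - betaJ c' D j + s) * (y : ℂ) ^ s / (s - betaMu D μ) ^ 2)‖ ≤
          C * Real.exp (-(c * ell D ^ (1 / 10 : ℝ)))) :
    ∃ C : ℝ, ForAllLarge fun D _ χ => AssumptionA D χ →
      ∀ j ∈ ({1, 2, 3} : Finset ℕ), ∀ μ ∈ ({6, 7} : Finset ℕ), ∀ y : ℝ, bigT D < y → y < bigP D →
        ‖(∑ m ∈ Finset.Ico 1 ⌈y⌉₊, χ (m : ZMod D) / (m : ℂ) ^ (1 - betaJ c' D j) *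
              ((y / m : ℝ) : ℂ) ^ betaMu D μ * (Real.log (y / m) : ℂ)) -
          deriv χ.LFunction 1 * ((2 * π * I)⁻¹ * (∮ s in C((0 : ℂ), 5 * alpha D),
            (y : ℂ) ^ s * (s - betaJ c' D j) / (s - betaMu D μ) ^ 2))‖ ≤ C * (ell D ^ 6)⁻¹ := by
  obtain ⟨c, hc, Ca, Da, ha⟩ := h030a
  obtain ⟨Cb, Db, hb⟩ := circle82_sub_le c'
  set K : ℝ := (Nat.factorial 60 : ℝ) / c ^ 60 with hK
  have hK0 : 0 ≤ K := by positivity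
  refine ⟨max Ca 0 * K + Cb, max (max Da Db) ⌈Real.exp 3⌉₊,
    fun D _ χ hD hq hp hA j hj μ hμ y hTy hyP => ?_⟩
  have hDa : Da ≤ D := le_trans (le_trans (le_max_left _ _) (le_max_left _ _)) hD
  have hDb : Db ≤ D := le_trans (le_trans (le_max_right _ _) (le_max_left _ _)) hD
  have hℓ3 : 3 ≤ ell D := three_le_ell (le_refl _) (le_trans (le_max_right _ _) hD)
  have hℓ0 : 0 < ell D := by linarith
  have e1 := ha D χ hDa hq hp hA j hj μ hμ y hTy hyP
  have e2 := hb D χ hDb hq hp hA j μ y hTy hyP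
  have hε : Real.exp (-(c * ell D ^ (1 / 10 : ℝ))) ≤ K * (ell D ^ 6)⁻¹ :=
    exp_neg_rpow_tenth_le hc hℓ0
  have e1' : ‖(∑ m ∈ Finset.Ico 1 ⌈y⌉₊, χ (m : ZMod D) / (m : ℂ) ^ (1 - betaJ c' D j) *
        ((y / m : ℝ) : ℂ) ^ betaMu D μ * (Real.log (y / m) : ℂ)) -
      (2 * π * I)⁻¹ * (∮ s in C((0 : ℂ), 5 * alpha D),
        χ.LFunction (1 - betaJ c' D j + s) * (y : ℂ) ^ s / (s - betaMu D μ) ^ 2)‖ ≤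
      max Ca 0 * K * (ell D ^ 6)⁻¹ :=
    calc _ ≤ Ca * Real.exp (-(c * ell D ^ (1 / 10 : ℝ))) := e1
      _ ≤ max Ca 0 * Real.exp (-(c * ell D ^ (1 / 10 : ℝ))) :=
          mul_le_mul_of_nonneg_right (le_max_left _ _) (Real.exp_pos _).le
      _ ≤ max Ca 0 * (K * (ell D ^ 6)⁻¹) := mul_le_mul_of_nonneg_left hε (le_max_right _ _)
      _ = max Ca 0 * K * (ell D ^ 6)⁻¹ := by ring
  calc _ ≤ _ + _ := norm_sub_le_norm_sub_add_norm_sub _ _ _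
    _ ≤ max Ca 0 * K * (ell D ^ 6)⁻¹ + Cb * (ell D ^ 6)⁻¹ := add_le_add e1' e2
    _ = (max Ca 0 * K + Cb) * (ell D ^ 6)⁻¹ := by ring

end Literature.NumberTheory.LFunctions.Zhang2022.Section8Lemma82Steps
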